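import Literature.NumberTheory.Rogawski1990.ArchBouazizClassMapG        -- ★-to-be (7) F0, LH3-p04 (g7): `bzClassMapG`, `continuous_bzClassMapG`, `bzClassMapG_congr`
import Literature.NumberTheory.Rogawski1990.ArchBouazizClassDescent     -- ★ p851524 (LH10-p02 (g7)), the `H`-twin: §1 `contDiff_ofReal_mul_of_tsupport_subset`, `exists_contDiff_eq_one_closedBall_tsupport_subset`
import Literature.NumberTheory.Rogawski1990.ArchHCSpaceGStableSum       -- ★ p851937 (LH10-p02 (g9)): `isOpen_stInRegG`; brings ★ `ArchStableSumG` (`StInRegG`, `regG_subset_stInRegG`, `hcSwapAt`), ★ `archRG`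
import HarnessLib

/-!
# (Σ4c-G) DESCENT THROUGH THE CLASS MAP OF THE `G′`-CHARTS AT A REGULAR CHART POINT — the ASSEMBLY: a smooth local section of `bzClassMapG S′` + the fibre identity «same
# class ⇒ same `Ψ∕Φ`» ⇒ `∃ F ∈ C^∞(class space), F(bzClassMapG S′ c) · Φ c = Ψ c` near the base class (N8-INNER (7) «(Σ-REG-G)», file F6a; Bouaziz 1994 §5.1, Varadarajan 1989 §6.4)

Topic `NumberTheory/Rogawski1990`; namespace `Literature.NumberTheory.Rogawski1990`.  THEOREMS ONLY (no `def`, no instance, no notation, no axiom, no named fact, no `sorry`).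
Cell `pub/hodgecm-mathlib`, crux H413 (`stmt-HodgeConjecture-24833`), line LH2 (closer stub `stub_N8`, organ (Sh)′), N8-INNER road (dealer LH2-plan (g1), RULING (7) 15:59:55Z),
brick **(7) «(Σ-REG-G)»** (owner LH3-p04 (g7)), file **F6 `…ClassDescentG`**, layer (a): the `G′`-twin, token for token, of ★ `exists_classDescent_of_section_of_descent`
(`ArchBouazizClassDescent`, p851524).  Author F0P3a-p04 (g27) (whose lineage g25 cut the `H`-side (Σ4c) interface).  Count-neutral.

THE STEP.  Fix a chart label `S′`, a `G`-regular base point `c₀ ∈ RegG S′` (★ `RegG`), and a function `Φ` smooth on the stable-regular set `StInRegG S′` (★, open: ★ `isOpen_stInRegG`)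
that does not vanish at the regular points whose class datum (★ `bzClassMapG S′`, LH3-p04's F0) is `ε₀`-close to `b₀ = bzClassMapG S′ c₀` (in the road: `Φ = stableSumG (orbFamGExt
L β ν a₀) S′` for the positive test function of F5).  ASSUME (sec): a `C^∞` local section `σ` of `bzClassMapG S′` on an open `U ∋ b₀` with `σ b₀ = c₀` (file F3, LH10-p02 (g9),
over ★ `SimpleRootBranchCubic`); and (desc): for every `Ψ` in a given covariance class `Cov` (in the road: (P) `2π`-periodicity in the angle slots + the chart-`S′` slice of ★
`ArchHcStableWeyl`), equal classes of regular points give `Φ c′ ≠ 0 ∧ Ψ c ∕ Φ c = Ψ c′ ∕ Φ c′` (file F6c, over the fibre description F6b).  THEN there is `ε ∈ (0, ε₀]` such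
that every `Ψ ∈ Cov` smooth on `StInRegG S′` DESCENDS: `∃ F ∈ C^∞(W → ℂ × ℂ × ℂ)` with `F (bzClassMapG S′ c) · Φ c = Ψ c` for all `c ∈ RegG S′` with `dist (bzClassMapG S′ c) b₀ < ε`
— `ε` BEFORE `Ψ`, as the (Σ-REG-G) organ (RULING (7)(a)) wants it.  The covariance class enters ONLY through (desc), so it is a parameter `Cov` here (F6c instantiates it).
PROOF (as on `H`): shrink `U` so that `σ` lands in `RegG S′` with class in the `ε₀`-ball; take `r` with `ball b₀ r ⊆ U′`, `ε = min (r∕3) ε₀`, a smooth cutoff `χ ≡ 1` on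
`closedBall b₀ ε` supported in `ball b₀ 2ε` (★ `exists_contDiff_eq_one_closedBall_tsupport_subset`); `F := χ · (Ψ ∘ σ)∕(Φ ∘ σ)` is `C^∞` everywhere (★
`contDiff_ofReal_mul_of_tsupport_subset`), and at a regular `c` with class `ε`-close, `σ(class c)` is regular with the same class, so (desc) gives `F(class c) · Φ c = Ψ c`.
* §1 **`exists_classDescentG_of_section_of_descent`** (the statement above).
HONEST LABEL: (Sh)′ ∕ row `stub_N8` stay PRINT-labelled until the N8-INNER junction is ★ and ED. 43 re-keys 27456; HC_CM is proved only modulo the 7 printed citations (2 remaining: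
hLiu418 = stmt-HodgeConjecture-24832, h413 = stmt-HodgeConjecture-24833) until rung 0 closes; topology∕calculus bookkeeping, pays nothing by itself.

## References
* [Bouaziz1994IntegralesOrbitales] A. Bouaziz, *Intégrales orbitales sur les groupes de Lie réductifs*, Ann. Sci. ÉNS (4) 27 (1994) 573–609, §2.3 Lemme 2.3.1 p. 578, §5.1 p. 588.
* [Varadarajan1989] V. S. Varadarajan, *An Introduction to Harmonic Analysis on Semisimple Lie Groups*, Cambridge Stud. Adv. Math. 16 (1989), §6.4 Thms. 22–23 (pp. 189–190).
* [HormanderALPDO1] L. Hörmander, *The Analysis of Linear Partial Differential Operators I*, 2nd ed. (1990), §1.4 Thm. 1.4.1 (smooth cutoffs).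
-/

set_option autoImplicit false

noncomputable section

open Complex Set Function Real Metric Topology Filter
open scoped ContDiff
open Literature.NumberTheory.Automorphic.ArchCartan

namespace Literature.NumberTheory.Rogawski1990

/-! ## §1 The assembly of (Σ4c-G) from (sec) + (desc) -/

section Descent

variable {W : Type*} [Fintype W] [DecidableEq W]

/-- **(Σ4c-G) DESCENT THROUGH THE CLASS MAP OF THE `G′`-CHARTS, MODULO (sec) + (desc).**  `S′` a chart label, `c₀ ∈ RegG S′`, `Φ` smooth on `StInRegG S′` and non-zero at the
regular points whose class is `ε₀`-close to `b₀ = bzClassMapG S′ c₀`.  ASSUME (sec): a `C^∞` local section `σ` of `bzClassMapG S′` on an open `U ∋ b₀` with `σ b₀ = c₀`; and (desc):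
for every `Ψ` of the covariance class `Cov`, equal classes of regular points give `Φ c′ ≠ 0 ∧ Ψ c ∕ Φ c = Ψ c′ ∕ Φ c′`.  THEN there is `ε ∈ (0, ε₀]` such that every `Ψ ∈ Cov`
smooth on `StInRegG S′` DESCENDS: `∃ F ∈ C^∞(W → ℂ × ℂ × ℂ)`, `F (bzClassMapG S′ c) · Φ c = Ψ c` for all `c ∈ RegG S′` with `dist (bzClassMapG S′ c) b₀ < ε` (`ε` BEFORE `Ψ`).  The
`G′`-twin of ★ `exists_classDescent_of_section_of_descent`. [cite: Bouaziz1994IntegralesOrbitales, §5.1 p. 588] [cite: Varadarajan1989, §6.4 Thms. 22–23] -/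
theorem exists_classDescentG_of_section_of_descent (S' : Finset W) {c₀ : W → Fin 3 → ℝ} (hc₀ : c₀ ∈ RegG S') (Φ : (W → Fin 3 → ℝ) → ℂ) {ε₀ : ℝ} (hε₀ : 0 < ε₀)
    (hΦs : ContDiffOn ℝ ∞ Φ (StInRegG S')) (hΦ0 : ∀ c ∈ RegG S', dist (bzClassMapG S' c) (bzClassMapG S' c₀) < ε₀ → Φ c ≠ 0)
    (hsec : ∃ U : Set (W → ℂ × ℂ × ℂ), IsOpen U ∧ bzClassMapG S' c₀ ∈ U ∧ ∃ σ : (W → ℂ × ℂ × ℂ) → (W → Fin 3 → ℝ), ContDiffOn ℝ ∞ σ U ∧ σ (bzClassMapG S' c₀) = c₀ ∧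
      ∀ c : W → Fin 3 → ℝ, bzClassMapG S' c ∈ U → bzClassMapG S' (σ (bzClassMapG S' c)) = bzClassMapG S' c)
    (Cov : ((W → Fin 3 → ℝ) → ℂ) → Prop)
    (hdesc : ∀ Ψ : (W → Fin 3 → ℝ) → ℂ, Cov Ψ →
      ∀ {c c' : W → Fin 3 → ℝ}, c ∈ RegG S' → c' ∈ RegG S' → bzClassMapG S' c = bzClassMapG S' c' → Φ c ≠ 0 → Φ c' ≠ 0 ∧ Ψ c / Φ c = Ψ c' / Φ c') :
    ∃ ε : ℝ, 0 < ε ∧ ε ≤ ε₀ ∧ ∀ Ψ : (W → Fin 3 → ℝ) → ℂ, Cov Ψ → ContDiffOn ℝ ∞ Ψ (StInRegG S') →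
      ∃ F : (W → ℂ × ℂ × ℂ) → ℂ, ContDiff ℝ ∞ F ∧ ∀ c ∈ RegG S', dist (bzClassMapG S' c) (bzClassMapG S' c₀) < ε → F (bzClassMapG S' c) * Φ c = Ψ c := by
  obtain ⟨U, hU, hb₀, σ, hσ, hσ₀, hσsec⟩ := hsec
  have hσc : ContinuousOn σ U := hσ.continuousOn
  -- shrink `U`: `σ` lands in `RegG S′` and `bzClassMapG S′ ∘ σ` in the `ε₀`-ball
  have hU₁ : IsOpen (U ∩ σ ⁻¹' RegG S') := hσc.isOpen_inter_preimage hU (isOpen_regG S')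
  have hκc : ContinuousOn (fun y => bzClassMapG S' (σ y)) (U ∩ σ ⁻¹' RegG S') :=
    (continuous_bzClassMapG S').comp_continuousOn (hσc.mono inter_subset_left)
  have hU' : IsOpen ((U ∩ σ ⁻¹' RegG S') ∩ (fun y => bzClassMapG S' (σ y)) ⁻¹' ball (bzClassMapG S' c₀) ε₀) := hκc.isOpen_inter_preimage hU₁ isOpen_ball
  have hb₀' : bzClassMapG S' c₀ ∈ (U ∩ σ ⁻¹' RegG S') ∩ (fun y => bzClassMapG S' (σ y)) ⁻¹' ball (bzClassMapG S' c₀) ε₀ := by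
    refine ⟨⟨hb₀, ?_⟩, ?_⟩
    · rw [mem_preimage, hσ₀]; exact hc₀
    · rw [mem_preimage, hσ₀]; exact mem_ball_self hε₀
  obtain ⟨r, hr, hball⟩ := Metric.isOpen_iff.1 hU' _ hb₀'
  -- the radius and the cutoff
  set ε : ℝ := min (r / 3) ε₀ with hεdef
  have hε : 0 < ε := lt_min (by positivity) hε₀
  have hεr : 2 * ε < r := by
    have : ε ≤ r / 3 := min_le_left _ _
    linarith
  obtain ⟨χ, hχ, hχ1, hχsupp⟩ := exists_contDiff_eq_one_closedBall_tsupport_subset (bzClassMapG S' c₀) hε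
  have hsuppU : tsupport χ ⊆ (U ∩ σ ⁻¹' RegG S') ∩ (fun y => bzClassMapG S' (σ y)) ⁻¹' ball (bzClassMapG S' c₀) ε₀ :=
    hχsupp.trans ((ball_subset_ball hεr.le).trans hball)
  refine ⟨ε, hε, min_le_right _ _, fun Ψ hΨC hΨs => ?_⟩
  -- the descended function
  have hmaps : MapsTo σ ((U ∩ σ ⁻¹' RegG S') ∩ (fun y => bzClassMapG S' (σ y)) ⁻¹' ball (bzClassMapG S' c₀) ε₀) (StInRegG S') :=
    fun y hy => regG_subset_stInRegG S' hy.1.2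
  have hσ' : ContDiffOn ℝ ∞ σ ((U ∩ σ ⁻¹' RegG S') ∩ (fun y => bzClassMapG S' (σ y)) ⁻¹' ball (bzClassMapG S' c₀) ε₀) :=
    hσ.mono (inter_subset_left.trans inter_subset_left)
  have hΨσ : ContDiffOn ℝ ∞ (fun y => Ψ (σ y)) ((U ∩ σ ⁻¹' RegG S') ∩ (fun y => bzClassMapG S' (σ y)) ⁻¹' ball (bzClassMapG S' c₀) ε₀) := hΨs.comp hσ' hmaps
  have hΦσ : ContDiffOn ℝ ∞ (fun y => Φ (σ y)) ((U ∩ σ ⁻¹' RegG S') ∩ (fun y => bzClassMapG S' (σ y)) ⁻¹' ball (bzClassMapG S' c₀) ε₀) := hΦs.comp hσ' hmaps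
  have hΦσ0 : ∀ y ∈ (U ∩ σ ⁻¹' RegG S') ∩ (fun y => bzClassMapG S' (σ y)) ⁻¹' ball (bzClassMapG S' c₀) ε₀, Φ (σ y) ≠ 0 :=
    fun y hy => hΦ0 (σ y) hy.1.2 (mem_ball.1 hy.2)
  have hg : ContDiffOn ℝ ∞ (fun y => Ψ (σ y) * (Φ (σ y))⁻¹) ((U ∩ σ ⁻¹' RegG S') ∩ (fun y => bzClassMapG S' (σ y)) ⁻¹' ball (bzClassMapG S' c₀) ε₀) :=
    hΨσ.mul (hΦσ.inv hΦσ0)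
  refine ⟨fun y => ((χ y : ℝ) : ℂ) * (Ψ (σ y) * (Φ (σ y))⁻¹), contDiff_ofReal_mul_of_tsupport_subset hU' hχ hsuppU hg, fun c hc hdist => ?_⟩
  -- the identity at a regular point whose class is `ε`-close
  have hy : bzClassMapG S' c ∈ (U ∩ σ ⁻¹' RegG S') ∩ (fun y => bzClassMapG S' (σ y)) ⁻¹' ball (bzClassMapG S' c₀) ε₀ :=
    hball (mem_ball.2 (hdist.trans (by linarith)))
  have hc' : σ (bzClassMapG S' c) ∈ RegG S' := hy.1.2
  have hcls : bzClassMapG S' c = bzClassMapG S' (σ (bzClassMapG S' c)) := (hσsec c hy.1.1).symm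
  have hΦc : Φ c ≠ 0 := hΦ0 c hc (hdist.trans_le (min_le_right _ _))
  obtain ⟨hΦc', hq⟩ := hdesc Ψ hΨC hc hc' hcls hΦc
  have h1 : χ (bzClassMapG S' c) = 1 := hχ1 _ (mem_closedBall.2 hdist.le)
  show ((χ (bzClassMapG S' c) : ℝ) : ℂ) * (Ψ (σ (bzClassMapG S' c)) * (Φ (σ (bzClassMapG S' c)))⁻¹) * Φ c = Ψ c
  rw [h1, Complex.ofReal_one, one_mul, ← div_eq_mul_inv, ← hq, div_mul_cancel₀ _ hΦc]

/-- **THE SAME WITH `Φ` POSITIVE ON THE WHOLE NEIGHBOURHOOD READ IN COORDINATES** — a convenience form where the non-vanishing of `Φ` is given on the regular points whose split slots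
are bounded by `R` (the shape of F5's ★-to-be positive test function: `Φ c ≠ 0` whenever `∀ w ∈ S′, |c w 0| ≤ R`) together with a bound `|c w 0| ≤ R` valid `ε₀`-close to the base class
(F1's (g4)): then the hypothesis `hΦ0` of `exists_classDescentG_of_section_of_descent` holds. [cite: Bouaziz1994IntegralesOrbitales, §5.1 p. 588] -/
theorem classDescentG_nonvanishing_of_slotBound (S' : Finset W) (c₀ : W → Fin 3 → ℝ) (Φ : (W → Fin 3 → ℝ) → ℂ) {ε₀ R : ℝ}
    (hΦR : ∀ c ∈ RegG S', (∀ w, w ∈ S' → |c w 0| ≤ R) → Φ c ≠ 0)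
    (hxbd : ∀ c : W → Fin 3 → ℝ, dist (bzClassMapG S' c) (bzClassMapG S' c₀) < ε₀ → ∀ w, w ∈ S' → |c w 0| ≤ R) :
    ∀ c ∈ RegG S', dist (bzClassMapG S' c) (bzClassMapG S' c₀) < ε₀ → Φ c ≠ 0 :=
  fun c hc hd => hΦR c hc (hxbd c hd)

end Descent

end Literature.NumberTheory.Rogawski1990

end
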